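import Mathlib
import Literature.RingTheory.KrullDimension.AffineDimension
import Summits.ResolutionOfSingularities.ResolutionOfSingularities.Theorems.WeightedInvariantLocalWeightedDropTOT2PlanePolynomials
import Summits.ResolutionOfSingularities.ResolutionOfSingularities.Theorems.WeightedInvariantLocalWeightedDropNCBranchPrimesSymbolic

/-!
# TOT2-LINE (P3) brick B5-D3, part 2/2: `pairVal_lt_top` — DISTINCT TOP-LOCUS BRANCHES HAVE DISTINCT PLANE PROJECTIONS

Sub-problem `ResolutionOfSingularities`, ENGINE crux `stmt-ResolutionOfSingularities-8899` (`LocalWeightedDrop`), skeleton v35 (2e806da509994632),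
registered stub `stub_conflictBudget` (P3); dictionary brick B5-D3 of res-L1-w43-stub-2 g6's split (v1.1 signature of 2026-08-27T20:27:54Z,
re-typed by res-L1-w43-plan-1 RULING (D3-retype) 20:24:41Z after res-L1-type-o6's witness `(y − u₁²)^d`: both primes one-dimensional), proved
VERBATIM (this hand res-L1-w43-stub-1 g7).  [OURS · L1 W4.3 · chain w43.  Engine bookkeeping: nothing here is a statement of any manuscript;
AI-produced, gate-checked, weaker than expert review.  «[OURS · L1 W4.3] replaces the role of nothing printed; NOT a statement of the manuscript.»]

THE ARGUMENT (no parametrisation, no normalisation of the plane branch, no Weierstrass uniqueness).  Let `P ≠ P′` be one-dimensional primes of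
`R₃ = k⟦u₁,u₂,y⟧` with `s F ∈ P^d`, `s′ F ∈ P′^d` (`F` the monic germ, `d ≥ 2`) and plane contractions `𝔮 = P ∩ k⟦u⟧`, `𝔮′`.
* `k⟦u⟧ ⧸ 𝔮 ↪ R₃ ⧸ P` is integral (part 1, complete Nakayama), so `dim k⟦u⟧ ⧸ 𝔮 = 1` (Matsumura 9.4, `ringKrullDim_eq_of_isIntegral`):
  `ringKrullDim_quotient_comap_toThree_eq_one`; hence `𝔮′ ⊆ 𝔮` forces `𝔮′ = 𝔮` (`eq_maximalIdeal_of_lt_of_ringKrullDim`).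
* Over `L = Frac(k⟦u⟧ ⧸ 𝔮)` the polynomial `F̂` has a UNIQUE monic irreducible factor (`eq_of_monic_irreducible_dvd_pow`): in `Frac(R₃ ⧸ P)[Y]` it is
  `(Y − ȳ)^d` by the Taylor form of part 1, and monic divisors of a prime power are powers; so the ideal of plane polynomials
  `{g ∈ k⟦u⟧[Y] | g(y) ∈ P}` is `{g | q ∣ ḡ}` for ANY monic irreducible factor `q` of `F̂` over `L` (`eval₂_mem_iff_dvd`, via `minpoly.dvd_iff`) —
  it depends on `(𝔮, F)` only.
* Every `x ∈ R₃` is `≡ g(y) (mod P ∩ P′)` for a plane polynomial `g` (part 1 `exists_polynomial_sub_mem`); so `𝔮 = 𝔮′` gives `P = P′`.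
Hence some plane series lies in `P′ ∖ P`, and `pairVal P P′ ≤ v_P(it) < ⊤` (`pairVal_lt_top`).
-/

set_option linter.dupNamespace false -- mandated namespace of this single-conjunct summit

noncomputable section

namespace Summit.ResolutionOfSingularities.ResolutionOfSingularities.Theorems

namespace TOT2Branch

open MvPowerSeries IsLocalRing

variable {k : Type} [Field k]

/-! ## Dimension one: primes above, and the plane contraction of a top-locus prime -/

/-- In a local ring, a prime strictly above a prime `P` with `dim R ⧸ P = 1` is the maximal ideal. -/
theorem eq_maximalIdeal_of_lt_of_ringKrullDim {R : Type*} [CommRing R] [IsLocalRing R] {P Q : Ideal R} [P.IsPrime] [Q.IsPrime]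
    (hdim : ringKrullDim (R ⧸ P) = 1) (hPQ : P < Q) : Q = maximalIdeal R := by
  rw [ringKrullDim_quotient] at hdim
  rcases Order.krullDim_le_one_iff.mp hdim.le ⟨⟨Q, ‹_›⟩, hPQ.le⟩ with hmin | hmax
  · exfalso
    have h : (⟨⟨P, ‹_›⟩, le_refl P⟩ : PrimeSpectrum.zeroLocus (R := R) (P : Set R)) ≤ ⟨⟨Q, ‹_›⟩, hPQ.le⟩ := hPQ.le
    exact absurd (le_antisymm hPQ.le (hmin h)) (ne_of_lt hPQ)
  · have hQm : Q ≤ maximalIdeal R := IsLocalRing.le_maximalIdeal (Ideal.IsPrime.ne_top ‹_›)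
    have h : (⟨⟨Q, ‹_›⟩, hPQ.le⟩ : PrimeSpectrum.zeroLocus (R := R) (P : Set R)) ≤
        ⟨⟨maximalIdeal R, inferInstance⟩, hPQ.le.trans hQm⟩ := hQm
    exact le_antisymm hQm (hmax h)

/-- **The plane contraction of a one-dimensional prime containing the monic germ is one-dimensional**: `k⟦u₁,u₂⟧ ⧸ 𝔮 ↪ R₃ ⧸ P` is injective and
integral (part 1 `isIntegral_mk_comp_toThree`), so the dimensions agree (Matsumura 9.4). -/
theorem ringKrullDim_quotient_comap_toThree_eq_one {d : ℕ} (A : Fin d → MvPowerSeries (Fin 2) k) {P : Ideal (MvPowerSeries (Fin 3) k)}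
    [hP : P.IsPrime] (hF : NCPoly.monicGerm d A ∈ P) (hdim : ringKrullDim (MvPowerSeries (Fin 3) k ⧸ P) = 1) :
    ringKrullDim (MvPowerSeries (Fin 2) k ⧸ P.comap (toThree (k := k) : MvPowerSeries (Fin 2) k →+* MvPowerSeries (Fin 3) k)) = 1 := by
  have hint := isIntegral_mk_comp_toThree A hP.ne_top hF
  letI : Algebra (MvPowerSeries (Fin 2) k ⧸ P.comap (toThree (k := k) : MvPowerSeries (Fin 2) k →+* MvPowerSeries (Fin 3) k))
      (MvPowerSeries (Fin 3) k ⧸ P) :=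
    (Ideal.quotientMap P (toThree (k := k) : MvPowerSeries (Fin 2) k →+* MvPowerSeries (Fin 3) k) le_rfl).toAlgebra
  haveI : Algebra.IsIntegral (MvPowerSeries (Fin 2) k ⧸ P.comap (toThree (k := k) : MvPowerSeries (Fin 2) k →+* MvPowerSeries (Fin 3) k))
      (MvPowerSeries (Fin 3) k ⧸ P) := by
    refine ⟨fun x => ?_⟩
    obtain ⟨p, hp, hpx⟩ := hint x
    refine ⟨p.map (Ideal.Quotient.mk _), hp.map _, ?_⟩
    rw [Polynomial.eval₂_map, RingHom.algebraMap_toAlgebra, Ideal.quotientMap_comp_mk]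
    exact hpx
  rw [← hdim]
  exact Literature.RingTheory.KrullDimension.ringKrullDim_eq_of_isIntegral Ideal.quotientMap_injective

/-! ## Over a field: monic irreducible polynomials becoming powers of one linear factor in an extension coincide -/

/-- **Uniqueness of the irreducible factor**: two monic irreducible polynomials over a field `L` which, in an extension `K`, both divide a power
`(Y − γ)^n` are equal (their images are powers of `Y − γ`, so one divides the other already over `L`). -/
theorem eq_of_monic_irreducible_dvd_pow {L K : Type*} [Field L] [Field K] (φ : L →+* K) (γ : K) (n : ℕ) {q₁ q₂ : Polynomial L}
    (h₁m : q₁.Monic) (h₁i : Irreducible q₁) (h₁d : q₁.map φ ∣ (Polynomial.X - Polynomial.C γ) ^ n)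
    (h₂m : q₂.Monic) (h₂i : Irreducible q₂) (h₂d : q₂.map φ ∣ (Polynomial.X - Polynomial.C γ) ^ n) : q₁ = q₂ := by
  obtain ⟨i₁, -, hi₁⟩ := (dvd_prime_pow (Polynomial.prime_X_sub_C γ) n).mp h₁d
  obtain ⟨i₂, -, hi₂⟩ := (dvd_prime_pow (Polynomial.prime_X_sub_C γ) n).mp h₂d
  have e₁ : q₁.map φ = (Polynomial.X - Polynomial.C γ) ^ i₁ :=
    Polynomial.eq_of_monic_of_associated (h₁m.map φ) ((Polynomial.monic_X_sub_C γ).pow i₁) hi₁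
  have e₂ : q₂.map φ = (Polynomial.X - Polynomial.C γ) ^ i₂ :=
    Polynomial.eq_of_monic_of_associated (h₂m.map φ) ((Polynomial.monic_X_sub_C γ).pow i₂) hi₂
  have key : ∀ {a b : Polynomial L} {i j : ℕ}, a.Monic → Irreducible a → Irreducible b → b.Monic →
      a.map φ = (Polynomial.X - Polynomial.C γ) ^ i → b.map φ = (Polynomial.X - Polynomial.C γ) ^ j → i ≤ j → a = b := by
    intro a b i j ham hai hbi hbm ha hb hij
    have hdvd : a.map φ ∣ b.map φ := by rw [ha, hb]; exact pow_dvd_pow _ hij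
    rw [Polynomial.map_dvd_map φ φ.injective ham] at hdvd
    exact Polynomial.eq_of_monic_of_associated ham hbm (hai.associated_of_dvd hbi hdvd)
  rcases le_total i₁ i₂ with h | h
  · exact key h₁m h₁i h₂i h₂m e₁ e₂ h
  · exact (key h₂m h₂i h₁i h₁m e₂ e₁ h).symm

/-! ## The ideal of plane polynomials of a top-locus prime depends only on its plane contraction -/

/-- The monic germ over the fraction field of the plane branch has a monic irreducible factor. -/
theorem exists_monic_irreducible_dvd_map_monicPoly {d : ℕ} (hd : 0 < d) (A : Fin d → MvPowerSeries (Fin 2) k)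
    (J : Ideal (MvPowerSeries (Fin 2) k)) [J.IsPrime] :
    ∃ q : Polynomial (FractionRing (MvPowerSeries (Fin 2) k ⧸ J)), q.Monic ∧ Irreducible q ∧
      q ∣ (WildMonic.monicPoly d A).map
        ((algebraMap (MvPowerSeries (Fin 2) k ⧸ J) (FractionRing (MvPowerSeries (Fin 2) k ⧸ J))).comp (Ideal.Quotient.mk J)) := by
  refine Polynomial.exists_monic_irreducible_factor _ fun hu => ?_
  have hm := (monic_monicPoly d A).map
    ((algebraMap (MvPowerSeries (Fin 2) k ⧸ J) (FractionRing (MvPowerSeries (Fin 2) k ⧸ J))).comp (Ideal.Quotient.mk J))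
  have h1 := hm.isUnit_iff.mp hu
  have h2 := congrArg Polynomial.natDegree h1
  rw [(monic_monicPoly d A).natDegree_map, WildMonic.natDegree_monicPoly, Polynomial.natDegree_one] at h2
  omega

/-- **THE IDEAL OF PLANE POLYNOMIALS OF A TOP-LOCUS PRIME.**  Let `P` be a prime of `R₃` with `s ∉ P`, `s F ∈ P^d` (`d ≥ 1`), let `J = P ∩ k⟦u₁,u₂⟧`
(`hJ`) and let `q` be ANY monic irreducible factor of `F̂` over `L = Frac(k⟦u⟧ ⧸ J)`.  Then for every plane polynomial `g ∈ k⟦u₁,u₂⟧[Y]`: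
`g(y) ∈ P ⟺ q ∣ ḡ` in `L[Y]`.  (In `Frac(R₃ ⧸ P)[Y]` the polynomial `F̂` is `(Y − ȳ)^d`, so the minimal polynomial of `ȳ` over `L` is the unique monic
irreducible factor of `F̂`, i.e. `q`; and `g(y) ∈ P ⟺ ḡ(ȳ) = 0 ⟺ minpoly ∣ ḡ`.) -/
theorem eval₂_mem_iff_dvd {d : ℕ} (hd : 0 < d) {A : Fin d → MvPowerSeries (Fin 2) k} {P : Ideal (MvPowerSeries (Fin 3) k)} [hP : P.IsPrime]
    {s : MvPowerSeries (Fin 3) k} (hs : s ∉ P) (hsF : s * NCPoly.monicGerm d A ∈ P ^ d)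
    {J : Ideal (MvPowerSeries (Fin 2) k)} [hJp : J.IsPrime]
    (hJ : P.comap (toThree (k := k) : MvPowerSeries (Fin 2) k →+* MvPowerSeries (Fin 3) k) = J)
    {q : Polynomial (FractionRing (MvPowerSeries (Fin 2) k ⧸ J))} (hqm : q.Monic) (hqi : Irreducible q)
    (hqF : q ∣ (WildMonic.monicPoly d A).map
      ((algebraMap (MvPowerSeries (Fin 2) k ⧸ J) (FractionRing (MvPowerSeries (Fin 2) k ⧸ J))).comp (Ideal.Quotient.mk J)))
    (g : Polynomial (MvPowerSeries (Fin 2) k)) :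
    g.eval₂ (toThree (k := k) : MvPowerSeries (Fin 2) k →+* MvPowerSeries (Fin 3) k) (X (Fin.last 2)) ∈ P ↔
      q ∣ g.map ((algebraMap (MvPowerSeries (Fin 2) k ⧸ J) (FractionRing (MvPowerSeries (Fin 2) k ⧸ J))).comp (Ideal.Quotient.mk J)) := by
  -- the four rings `S = k⟦u⟧ ⧸ J ⊂ L`, `D = R₃ ⧸ P ⊂ K` and the maps `ι : S → D`, `lam : L → K`
  have hle : J ≤ P.comap (toThree (k := k) : MvPowerSeries (Fin 2) k →+* MvPowerSeries (Fin 3) k) := hJ.ge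
  set ι : MvPowerSeries (Fin 2) k ⧸ J →+* MvPowerSeries (Fin 3) k ⧸ P :=
    Ideal.quotientMap P (toThree (k := k) : MvPowerSeries (Fin 2) k →+* MvPowerSeries (Fin 3) k) hle with hιdef
  have hιmk : ∀ r, ι (Ideal.Quotient.mk J r) = Ideal.Quotient.mk P (toThree r) := fun r => Ideal.quotientMap_mk
  have hιinj : Function.Injective ι := Ideal.quotientMap_injective' hJ.le
  have hg₀ : Function.Injective ((algebraMap (MvPowerSeries (Fin 3) k ⧸ P) (FractionRing (MvPowerSeries (Fin 3) k ⧸ P))).comp ι) :=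
    (IsFractionRing.injective (MvPowerSeries (Fin 3) k ⧸ P) (FractionRing (MvPowerSeries (Fin 3) k ⧸ P))).comp hιinj
  set lam : FractionRing (MvPowerSeries (Fin 2) k ⧸ J) →+* FractionRing (MvPowerSeries (Fin 3) k ⧸ P) :=
    IsFractionRing.lift hg₀ with hlamdef
  have hlam : ∀ x, lam (algebraMap (MvPowerSeries (Fin 2) k ⧸ J) (FractionRing (MvPowerSeries (Fin 2) k ⧸ J)) x) =
      algebraMap (MvPowerSeries (Fin 3) k ⧸ P) (FractionRing (MvPowerSeries (Fin 3) k ⧸ P)) (ι x) := fun x =>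
    IsFractionRing.lift_algebraMap hg₀ x
  letI : Algebra (FractionRing (MvPowerSeries (Fin 2) k ⧸ J)) (FractionRing (MvPowerSeries (Fin 3) k ⧸ P)) := lam.toAlgebra
  set γ : FractionRing (MvPowerSeries (Fin 3) k ⧸ P) :=
    algebraMap (MvPowerSeries (Fin 3) k ⧸ P) (FractionRing (MvPowerSeries (Fin 3) k ⧸ P)) (Ideal.Quotient.mk P (X (Fin.last 2))) with hγ
  set θ : MvPowerSeries (Fin 2) k →+* FractionRing (MvPowerSeries (Fin 2) k ⧸ J) :=
    (algebraMap (MvPowerSeries (Fin 2) k ⧸ J) (FractionRing (MvPowerSeries (Fin 2) k ⧸ J))).comp (Ideal.Quotient.mk J) with hθ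
  -- the square `lam ∘ θ = (D → K) ∘ (mk P) ∘ toThree`
  have hsq : lam.comp θ = ((algebraMap (MvPowerSeries (Fin 3) k ⧸ P) (FractionRing (MvPowerSeries (Fin 3) k ⧸ P))).comp
      (Ideal.Quotient.mk P)).comp (toThree (k := k) : MvPowerSeries (Fin 2) k →+* MvPowerSeries (Fin 3) k) := by
    refine RingHom.ext fun r => ?_
    simp only [RingHom.comp_apply, hθ]
    rw [hlam, hιmk, RingHom.coe_coe]
  -- `F̂` becomes `(Y − γ)^d` over `K`
  have hFK : ((WildMonic.monicPoly d A).map θ).map lam = (Polynomial.X - Polynomial.C γ) ^ d := by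
    rw [Polynomial.map_map, hsq, RingHom.comp_assoc, ← Polynomial.map_map, map_monicPoly_eq_X_sub_C_pow hs hsF, Polynomial.map_pow,
      Polynomial.map_sub, Polynomial.map_X, Polynomial.map_C]
  -- evaluation of plane polynomials
  have hev : ∀ g : Polynomial (MvPowerSeries (Fin 2) k),
      algebraMap (MvPowerSeries (Fin 3) k ⧸ P) (FractionRing (MvPowerSeries (Fin 3) k ⧸ P))
        (Ideal.Quotient.mk P (g.eval₂ (toThree (k := k) : MvPowerSeries (Fin 2) k →+* MvPowerSeries (Fin 3) k) (X (Fin.last 2)))) =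
      Polynomial.aeval γ (g.map θ) := by
    intro g
    rw [Polynomial.aeval_def, RingHom.algebraMap_toAlgebra, Polynomial.eval₂_map, hsq]
    exact Polynomial.hom_eval₂ g _
      ((algebraMap (MvPowerSeries (Fin 3) k ⧸ P) (FractionRing (MvPowerSeries (Fin 3) k ⧸ P))).comp (Ideal.Quotient.mk P)) _
  have haevalF : Polynomial.aeval γ ((WildMonic.monicPoly d A).map θ) = 0 := by
    rw [Polynomial.aeval_def, RingHom.algebraMap_toAlgebra, ← Polynomial.eval_map, hFK, Polynomial.eval_pow, Polynomial.eval_sub,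
      Polynomial.eval_X, Polynomial.eval_C, sub_self, zero_pow hd.ne']
  have hint : IsIntegral (FractionRing (MvPowerSeries (Fin 2) k ⧸ J)) γ :=
    ⟨(WildMonic.monicPoly d A).map θ, (monic_monicPoly d A).map θ, by rw [← Polynomial.aeval_def]; exact haevalF⟩
  -- the minimal polynomial of `γ` is the unique monic irreducible factor `q`
  have hmq : minpoly (FractionRing (MvPowerSeries (Fin 2) k ⧸ J)) γ = q := by
    refine eq_of_monic_irreducible_dvd_pow lam γ d (minpoly.monic hint) (minpoly.irreducible hint) ?_ hqm hqi ?_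
    · rw [← hFK]
      exact Polynomial.map_dvd lam (minpoly.dvd _ γ haevalF)
    · rw [← hFK]
      exact Polynomial.map_dvd lam hqF
  rw [← Ideal.Quotient.eq_zero_iff_mem,
    ← (IsFractionRing.injective (MvPowerSeries (Fin 3) k ⧸ P) (FractionRing (MvPowerSeries (Fin 3) k ⧸ P))).eq_iff, map_zero, hev,
    ← minpoly.dvd_iff, hmq]

/-! ## `pairVal_lt_top` -/

/-- **B5-D3 — DISTINCT TOP-LOCUS PRIMES HAVE DISTINCT PLANE PROJECTIONS** (split v1.1 signature, verbatim): for one-dimensional top-locus primes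
`P ≠ P′` of a label of degree `d ≥ 2`, some plane series lies in `P′` but not in `P`; hence `pairVal P P′ < ⊤`. -/
theorem pairVal_lt_top {d : ℕ} (hd : 2 ≤ d) {A : Fin d → MvPowerSeries (Fin 2) k} {P P' : Ideal (MvPowerSeries (Fin 3) k)}
    (hP : P ∈ topPrimes d A) (hP' : P' ∈ topPrimes d A) (hne : P ≠ P')
    (hdim : ringKrullDim (MvPowerSeries (Fin 3) k ⧸ P) = 1) (hdim' : ringKrullDim (MvPowerSeries (Fin 3) k ⧸ P') = 1) :
    pairVal P P' < ⊤ := by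
  haveI := hP.1
  haveI := hP'.1
  have hd0 : 0 < d := by omega
  obtain ⟨s, hs, hsF⟩ := hP.2.2
  obtain ⟨s', hs', hsF'⟩ := hP'.2.2
  have hF : NCPoly.monicGerm d A ∈ P := NCBranchPrimes.mem_of_mul_mem_pow hP.1 (by omega) hs hsF
  have hF' : NCPoly.monicGerm d A ∈ P' := NCBranchPrimes.mem_of_mul_mem_pow hP'.1 (by omega) hs' hsF'
  -- it suffices to find a plane series in `P′ ∖ P`
  suffices hex : ∃ g : MvPowerSeries (Fin 2) k, toThree g ∈ P' ∧ toThree g ∉ P by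
    obtain ⟨g, hg', hg⟩ := hex
    refine lt_of_le_of_lt (pairVal_le hg' hg) ?_
    rw [branchVal_eq (isDiscreteValuationRing_integralClosure P hdim), lt_top_iff_ne_top, Ne, addVal_mk_eq_top_iff P hdim]
    exact hg
  by_contra hall
  push Not at hall
  -- the plane contractions
  set 𝔮 : Ideal (MvPowerSeries (Fin 2) k) := P.comap (toThree (k := k) : MvPowerSeries (Fin 2) k →+* MvPowerSeries (Fin 3) k) with h𝔮
  set 𝔮' : Ideal (MvPowerSeries (Fin 2) k) := P'.comap (toThree (k := k) : MvPowerSeries (Fin 2) k →+* MvPowerSeries (Fin 3) k) with h𝔮'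
  haveI : 𝔮.IsPrime := Ideal.comap_isPrime _ _
  haveI : 𝔮'.IsPrime := Ideal.comap_isPrime _ _
  have hle : 𝔮' ≤ 𝔮 := fun g hg => hall g hg
  have hq1 : ringKrullDim (MvPowerSeries (Fin 2) k ⧸ 𝔮) = 1 := ringKrullDim_quotient_comap_toThree_eq_one A hF hdim
  have hq1' : ringKrullDim (MvPowerSeries (Fin 2) k ⧸ 𝔮') = 1 := ringKrullDim_quotient_comap_toThree_eq_one A hF' hdim'
  have hqm : 𝔮 ≠ maximalIdeal (MvPowerSeries (Fin 2) k) := by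
    intro h
    have hfield : IsField (MvPowerSeries (Fin 2) k ⧸ 𝔮) := by
      rw [h]
      exact (Ideal.Quotient.maximal_ideal_iff_isField_quotient _).mp inferInstance
    have h0 := ringKrullDim_eq_zero_of_isField hfield
    rw [hq1] at h0
    exact one_ne_zero h0
  have heq : 𝔮' = 𝔮 := by
    by_contra hne'
    exact hqm (eq_maximalIdeal_of_lt_of_ringKrullDim hq1' (lt_of_le_of_ne hle hne'))
  -- a common monic irreducible factor of `F̂` over `Frac(k⟦u⟧ ⧸ 𝔮)` describes the plane polynomials of BOTH primes
  obtain ⟨q, hqm', hqi, hqF⟩ := exists_monic_irreducible_dvd_map_monicPoly hd0 A 𝔮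
  have hchar := fun g => eval₂_mem_iff_dvd hd0 hs hsF (J := 𝔮) rfl hqm' hqi hqF g
  have hchar' := fun g => eval₂_mem_iff_dvd hd0 hs' hsF' (J := 𝔮) heq hqm' hqi hqF g
  -- hence `P = P′`
  apply hne
  have hI : P ⊓ P' ≠ ⊤ := ne_top_of_le_ne_top hP.1.ne_top inf_le_left
  have hFI : NCPoly.monicGerm d A ∈ P ⊓ P' := ⟨hF, hF'⟩
  ext x
  obtain ⟨g, -, hg⟩ := exists_polynomial_sub_mem A hI hFI x
  have h1 : x ∈ P ↔ g.eval₂ (toThree (k := k) : MvPowerSeries (Fin 2) k →+* MvPowerSeries (Fin 3) k) (X (Fin.last 2)) ∈ P :=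
    ⟨fun hx => (Submodule.sub_mem_iff_right _ hx).mp hg.1, fun hgm => (Submodule.sub_mem_iff_left _ hgm).mp hg.1⟩
  have h2 : x ∈ P' ↔ g.eval₂ (toThree (k := k) : MvPowerSeries (Fin 2) k →+* MvPowerSeries (Fin 3) k) (X (Fin.last 2)) ∈ P' :=
    ⟨fun hx => (Submodule.sub_mem_iff_right _ hx).mp hg.2, fun hgm => (Submodule.sub_mem_iff_left _ hgm).mp hg.2⟩
  rw [h1, h2, hchar g, hchar' g]

end TOT2Branch

end Summit.ResolutionOfSingularities.ResolutionOfSingularities.Theorems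

end
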